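/-
COR-CM (cell pub-hodgecm2, stage 2 of the Hodge ladder) — count-neutral junction «the Weil-FOURFOLD (Markman) families of the
degree-12 census, from TYPE READINGS» (seat prover-pub-hodgecm2-b09-g22-0, binder prover b09, gen 22; own lane DEG12-MARKMAN-FRAME,
HOME/INBOX.md l.5648 — complement BY NAME to seat b23's DEG12-MARKMAN-TRANSPORT l.5632, whose `…OfMarkman` transports take
`HodgeConjectureFor` of exactly these products as their `hHC` binder; seat b07's `CorCM/InducedCurveThreefoldHodgeOfMarkman.lean`
p304016 consumed BY NAME).  Theorems only; no definition, no named fact, nothing asserted; `Interfaces.lean` (C1), every E term,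
`B01/*`, `Transposition/*`, `HComp/*` untouched.  HONEST FRAMING (COORDINATOR RULING — HODGE FRAMING CORRECTION,
2026-08-21T11:55:35Z): `HC_CM` is NOT proved, here or anywhere in the tree.  Everything below is CONDITIONAL on the displayed named
fact `HodgeTheory.Markman2025_weilClasses_algebraic_abelianFourfold` (E. Markman's fourfold theorem); no period is produced.
T5 (coordinator ruling 15:33:56Z (3)): binder set of each closing theorem = {ONE named fact `hW4`} ∪ data descriptions — the
automorphism dictionary `(ε, hε)` (inhabited for every Galois CM field of the type: seat b23's `…DihedralIntrinsic` /
`…C6C2Intrinsic`) and two type READINGS (inhabited: `FaceCensus.exists_cmType_reads`); the code side conditions are DISCHARGED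
here by `decide`; no `¬` theorem in the tree against any binder; no contradiction derivable; checker: self
(prover-pub-hodgecm2-b09-g22-0), 2026-08-21.
-/
import Summits.HodgeConjecture.CorCM.FaceCensusInducedTypes
import Summits.HodgeConjecture.CorCM.InducedCurveThreefoldHodgeOfMarkman
import Summits.HodgeConjecture.CorCM.Census.DuodecicFaceGeneratorsDihedral
import Summits.HodgeConjecture.CorCM.Census.DuodecicFaceGeneratorsC6C2
import HarnessLib

/-!
# Degree 12: the Markman (Weil-fourfold) families `A_{Θ_E} × A_{Θ_T}` from type readings, types `D₆` and `ℤ/6×ℤ/2`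

Seat b07's Markman column of the degree-12 census (HOME/pub-hodgecm2-b07/ORBIT-COUNT.md v2.1 §7): modulo Markman's FOURFOLD theorem
the `D₆` field closure needs 4 face periods instead of 8 and the `ℤ/6×ℤ/2` closure 5 instead of 6, the saved faces being paid for
by the Weil classes of the fourfolds `E_a × T_j` — in the transport currency, by `HodgeConjectureFor` of the tree's products
`cmProdAV K h₃ 1 ![Θ_E, Θ_T]` for the two-type families whose codes `(a; t)` in seat b30's tables are

  `D₆` (`Census/DuodecicFaceGeneratorsDihedral.lean`):  seat b07's `(1365; 910)`, `(1365; 952)`, `(1386; 903)`, `(1386; 924)`,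
  `(1386; 945)` (HOME/pub-hodgecm2-b07/orbit-count/cert_b23_format.out) and seat b23's certified choice `(2730; 952)`, `(2730; 3598)`,
  `(1386; 924)`, `(1386; 1806)` (`Census/DuodecicFaceTransportDihedralOfMarkmanCerts.lean` p305112, HOME/INBOX l.5711: the minimum
  is FOUR families and every minimal choice uses both imaginary quadratic subfields);
  `ℤ/6×ℤ/2` (`Census/DuodecicFaceGeneratorsC6C2.lean`):  seat b07's `(1365; 910)`, `(1386; 945)` and seat b23's certified choice
  `(1365; 3640)` (`Census/DuodecicFaceTransportC6C2OfMarkman.lean` p305337); any other certified pair is ONE more line over §1.  Seat b07's `InducedCurveThreefold.hodgeConjectureFor_cmProdAV_inducedCMType_pair_of_markman`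
supplies `HodgeConjectureFor (cmProdAV M h₃ 1 ![Ψ^M, Φ^M])` for `Ψ` a type of an imaginary quadratic `k → M` and `Φ` a type of a
sextic CM field `L → M` not induced from `k ⊆ L`, GIVEN ONLY Markman's fourfold theorem.  This file is the FRAME between the two: for a
Galois CM field `K` with an automorphism dictionary `ε : Aut(K) ≃ Fin 12` multiplicative for the table and CM types `Θ_E`, `Θ_T`
READING AS `(a; t)` at a base embedding `σ₀`,

  `Θ_E = Ψ^K` with `k_a = K^{Stab(a)}` imaginary quadratic (`a ∈ {1365, 2730}`: `Stab = {g₀,g₂,g₄,g₆,g₈,g₁₀} = ⟨r², s⟩`, `Ψ = {σ₀|_k}`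
  resp. `{σ̄₀|_k}`; `a = 1386`: `Stab = {g₀,g₂,g₄,g₇,g₉,g₁₁} = ⟨r², sr⟩`, `Ψ = {σ̄₀|_k}`),  `Θ_T = Φ^K` with `L_t = K^{Stab(t)} ⊇ k_a`
  sextic CM (`Stab(t) = {g₀, g_j}` of order two) and `Φ` NOT induced from `k_a` (two codes of `t` in different `Stab(a)`-cosets),

all by the census dictionary `CorCM/FaceCensusInducedTypes.lean` with the code side conditions decided in the kernel; hence
(§1, one degree-free theorem `hodgeConjectureFor_cmProdAV_of_reads_of_masks` over any table; §2–§3 the eleven instances; §4 the two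
bundles `exists_families_d6` / `exists_families_c6c2` in seat b23's binder shape, types included by `FaceCensus.exists_cmType_reads`)

  `HodgeConjectureFor (cmProdAV K cmAbelianVarietyRealised_holds 1 ![Θ_E, Θ_T])`  GIVEN ONLY  `Markman2025_weilClasses_algebraic_abelianFourfold`.

Exact finite model: session `work/d6_model.py`, `work/c6c2_model.py` (stabilisers, containments, Milne witnesses, the `(2,2)` Hodge
check of each family weight, and b07's five certificates re-verified over all 64 type codes).  `HC_CM` is NOT proved.

References: [cite: Markman2025SurveySecant, Thm. 1.2]; [cite: Shimura1998, §6.2 Theorem 3, §8.1–§8.2]; [cite: Streng2010, Ch. I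
Def. 3.2]; [cite: MilneCM2006, Ch. I §1 p. 11]; [cite: MumfordAV1970, §19 Thm. 1 and p. 169]; [cite: DeligneMilne1982Tannakian, §6
Thm. 6.20]; [cite: Pohlmann1968, Thm. 1] (only through the reading conventions).
-/

noncomputable section

open NumberField NumberField.ComplexEmbedding
open Literature.AlgebraicGeometry Literature.AlgebraicGeometry.Motives Literature.AlgebraicGeometry.HodgeTheory
open Literature.NumberTheory.ComplexMultiplication (inducedCMType isCMField_of_cmType_intermediateField)
open Summit.HodgeConjecture.CorCM.Census.FaceSquaresModel
open Summit.HodgeConjecture.CorCM.FaceCensus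
open Summit.HodgeConjecture.CorCM.Domination

namespace Summit.HodgeConjecture.CorCM.DuodecicMarkmanFamilies

/-! ## §1 The frame over any census table: two reading-stable types ⟹ a Markman family -/

/-- **`HC(A_{Θ_E} × A_{Θ_T})` from type READINGS, over any census table (degree-free frame).**  `K` a Galois CM field with an
automorphism dictionary `ε : Aut(K) ≃ Fin n` multiplicative for `Γ`; code masks `SE ⊇ ST` containing `Γ.one`, closed under `Γ.mul`,
of sizes `n/2` and `n/6`; type codes `a`, `t` right-stable under `SE`, `ST` respectively; two codes `i₁, i₂ ∈ t` in different right
`SE`-cosets.  Then for ALL CM types `Θ_E`, `Θ_T` of `K` reading as `a`, `t` at `σ₀`, the tree's product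
`cmProdAV K cmAbelianVarietyRealised_holds 1 ![Θ_E, Θ_T] = A_{(K,Θ_E)} × A_{(K,Θ_T)}` satisfies the Hodge conjecture in every
codimension, GIVEN ONLY Markman's fourfold theorem: `Θ_E = Ψ^K` over the imaginary quadratic `K^{SE}`, `Θ_T = Φ^K` over the sextic
CM field `K^{ST} ⊇ K^{SE}` with `Φ` not induced from `K^{SE}` (`FaceCensusInducedTypes`), and seat b07's
`InducedCurveThreefold.hodgeConjectureFor_cmProdAV_inducedCMType_pair_of_markman`.  (FRAMING: conditional on that theorem; `HC_CM`
is not proved.) [cite: Markman2025SurveySecant, Thm. 1.2] [cite: Shimura1998, §6.2 Theorem 3 and §8.2]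
[cite: Streng2010, Ch. I Def. 3.2] [cite: MilneCM2006, Ch. I §1 p. 11] -/
theorem hodgeConjectureFor_cmProdAV_of_reads_of_masks (hW4 : Markman2025_weilClasses_algebraic_abelianFourfold)
    {n : ℕ} (Γ : CMGaloisType n) {K : Type} [Field K] [NumberField K] [IsCMField K] [IsGalois ℚ K]
    (ε : (K ≃ₐ[ℚ] K) ≃ Fin n) (hε : ∀ g h : K ≃ₐ[ℚ] K, ε (g * h) = Γ.mul (ε g) (ε h)) (σ₀ : K →+* ℂ)
    (h1 : Γ.mul Γ.one Γ.one = Γ.one) (SE ST a t : ℕ) (hE1 : mem Γ.one SE = true) (hT1 : mem Γ.one ST = true)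
    (hEcl : ∀ i j : Fin n, mem i SE = true → mem j SE = true → mem (Γ.mul i j) SE = true)
    (hTcl : ∀ i j : Fin n, mem i ST = true → mem j ST = true → mem (Γ.mul i j) ST = true)
    (hTE : ∀ j : Fin n, mem j ST = true → mem j SE = true)
    (hcardE : (Finset.univ.filter fun i : Fin n => mem i SE = true).card * 2 = n)
    (hcardT : (Finset.univ.filter fun i : Fin n => mem i ST = true).card * 6 = n)
    (hstabE : ∀ i j : Fin n, mem j SE = true → (mem (Γ.mul i j) a = true ↔ mem i a = true))
    (hstabT : ∀ i j : Fin n, mem j ST = true → (mem (Γ.mul i j) t = true ↔ mem i t = true))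
    (i₁ i₂ : Fin n) (hi₁ : mem i₁ t = true) (hi₂ : mem i₂ t = true) (hsep : ∀ j : Fin n, mem j SE = true → Γ.mul i₁ j ≠ i₂)
    (ΘE ΘT : CMType K) (hΘE : ∀ g : K ≃ₐ[ℚ] K, σ₀.comp (g : K →+* K) ∈ ΘE.1 ↔ mem (ε g) a = true)
    (hΘT : ∀ g : K ≃ₐ[ℚ] K, σ₀.comp (g : K →+* K) ∈ ΘT.1 ↔ mem (ε g) t = true) :
    HodgeConjectureFor (cmProdAV K cmAbelianVarietyRealised_holds 1 ![ΘE, ΘT]).dim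
      (cmProdAV K cmAbelianVarietyRealised_holds 1 ![ΘE, ΘT]).X := by
  classical
  -- the two subgroups and their fixed fields `k = K^{H_E} ⊆ L = K^{H_T}`
  obtain ⟨HE, hHE⟩ := exists_subgroup_of_mask Γ ε hε h1 SE hE1 hEcl
  obtain ⟨HT, hHT⟩ := exists_subgroup_of_mask Γ ε hε h1 ST hT1 hTcl
  have hle : HT ≤ HE := fun g hg => (hHE g).mpr (hTE _ ((hHT g).mp hg))
  have hkL : IntermediateField.fixedField HE ≤ IntermediateField.fixedField HT := fixedField_le_of_le hle
  -- the induced types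
  obtain ⟨Ψ, hΨ⟩ := exists_inducedCMType_of_reads Γ ε hε σ₀ HE hHE ΘE hΘE hstabE
  obtain ⟨Φ, hΦ⟩ := exists_inducedCMType_of_reads Γ ε hε σ₀ HT hHT ΘT hΘT hstabT
  haveI : IsCMField (IntermediateField.fixedField HE) := isCMField_of_cmType_intermediateField _ Ψ
  haveI : IsCMField (IntermediateField.fixedField HT) := isCMField_of_cmType_intermediateField _ Φ
  -- degrees
  have hn : Module.finrank ℚ K = n := by
    rw [← IsGalois.card_aut_eq_finrank, Nat.card_congr ε, Nat.card_eq_fintype_card, Fintype.card_fin]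
  have hposE : 0 < (Finset.univ.filter fun i : Fin n => mem i SE = true).card :=
    Finset.card_pos.mpr ⟨Γ.one, by rw [Finset.mem_filter]; exact ⟨Finset.mem_univ _, hE1⟩⟩
  have hposT : 0 < (Finset.univ.filter fun i : Fin n => mem i ST = true).card :=
    Finset.card_pos.mpr ⟨Γ.one, by rw [Finset.mem_filter]; exact ⟨Finset.mem_univ _, hT1⟩⟩
  have h2 : Module.finrank ℚ (IntermediateField.fixedField HE) = 2 := by
    have h := (finrank_fixedField_mul_card HE).trans (hn.trans hcardE.symm)
    rw [card_subgroup_of_mask ε HE hHE, mul_comm _ 2] at h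
    exact Nat.eq_of_mul_eq_mul_right hposE h
  have h6 : Module.finrank ℚ (IntermediateField.fixedField HT) = 6 := by
    have h := (finrank_fixedField_mul_card HT).trans (hn.trans hcardT.symm)
    rw [card_subgroup_of_mask ε HT hHT, mul_comm _ 6] at h
    exact Nat.eq_of_mul_eq_mul_right hposT h
  -- the inclusion `k → L` over `K` and Milne's non-inducedness
  have hi : (algebraMap (IntermediateField.fixedField HT) K).comp
      (IntermediateField.inclusion hkL : IntermediateField.fixedField HE →+* IntermediateField.fixedField HT) =
      algebraMap (IntermediateField.fixedField HE) K :=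
    RingHom.ext fun _ => rfl
  have hprim := exists_comp_ne_of_codes Γ ε hε σ₀ (H := HT) (H' := HE) hHE _ hi hΦ hΘT i₁ i₂ hi₁ hi₂ hsep
  -- seat b07's theorem on the induced pair, read back on `Θ_E`, `Θ_T`
  have h := InducedCurveThreefold.hodgeConjectureFor_cmProdAV_inducedCMType_pair_of_markman hW4 (M := K) h6
    (algebraMap (IntermediateField.fixedField HT) K) h2
    (IntermediateField.inclusion hkL : IntermediateField.fixedField HE →+* IntermediateField.fixedField HT)
    (algebraMap (IntermediateField.fixedField HE) K) Ψ hprim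
  rw [hΨ, hΦ] at h
  exact h

/-! ## §2 Type `D₆` (closures `k·F₀^{gal}` of the non-Galois sextic CM fields): eight families (b07 ∪ b23) -/

section D6

open Summit.HodgeConjecture.CorCM.Census.DuodecicFaceGeneratorsDihedral (Γ)

/-- **`D₆`, family `(1365; 910)`**: `Θ_E` reading as `{0,2,4,6,8,10}` (the subgroup `⟨r², s⟩`; `Θ_E = {σ₀|_{k₀}}^K`), `Θ_T` reading as
`{1,2,3,7,8,9}` (stabiliser `{1, sr⁴}`; induced from the sextic CM field `K^{⟨sr⁴⟩} ⊇ k₀`) ⟹ `HC(A_{Θ_E} × A_{Θ_T})` GIVEN ONLY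
Markman's fourfold theorem.  (FRAMING: conditional; `HC_CM` is not proved.) [cite: Markman2025SurveySecant, Thm. 1.2]
[cite: Shimura1998, §6.2 Theorem 3 and §8.2] -/
theorem hodgeConjectureFor_cmProdAV_of_reads_d6_1365_910
    (hW4 : Markman2025_weilClasses_algebraic_abelianFourfold) {K : Type} [Field K] [NumberField K] [IsCMField K]
    [IsGalois ℚ K] (ε : (K ≃ₐ[ℚ] K) ≃ Fin 12) (hε : ∀ g h : K ≃ₐ[ℚ] K, ε (g * h) = Γ.mul (ε g) (ε h)) (σ₀ : K →+* ℂ)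
    (ΘE ΘT : CMType K)
    (hΘE : ∀ g : K ≃ₐ[ℚ] K, σ₀.comp (g : K →+* K) ∈ ΘE.1 ↔ mem (ε g) 1365 = true)
    (hΘT : ∀ g : K ≃ₐ[ℚ] K, σ₀.comp (g : K →+* K) ∈ ΘT.1 ↔ mem (ε g) 910 = true) :
    HodgeConjectureFor (cmProdAV K cmAbelianVarietyRealised_holds 1 ![ΘE, ΘT]).dim
      (cmProdAV K cmAbelianVarietyRealised_holds 1 ![ΘE, ΘT]).X :=
  hodgeConjectureFor_cmProdAV_of_reads_of_masks hW4 Γ ε hε σ₀ (by decide +kernel) 1365 1025 1365 910 (by decide +kernel) (by decide +kernel)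
    (by decide +kernel) (by decide +kernel) (by decide +kernel) (by decide +kernel) (by decide +kernel) (by decide +kernel) (by decide +kernel) 1 2 (by decide +kernel) (by decide +kernel) (by decide +kernel)
    ΘE ΘT hΘE hΘT

/-- **`D₆`, family `(1365; 952)`**: `Θ_T` reading as `{3,4,5,7,8,9}` (stabiliser `{1, s}`; induced from `K^{⟨s⟩} ⊇ k₀`).
(FRAMING: conditional; `HC_CM` is not proved.) [cite: Markman2025SurveySecant, Thm. 1.2] [cite: Shimura1998, §6.2 Theorem 3 and §8.2] -/
theorem hodgeConjectureFor_cmProdAV_of_reads_d6_1365_952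
    (hW4 : Markman2025_weilClasses_algebraic_abelianFourfold) {K : Type} [Field K] [NumberField K] [IsCMField K]
    [IsGalois ℚ K] (ε : (K ≃ₐ[ℚ] K) ≃ Fin 12) (hε : ∀ g h : K ≃ₐ[ℚ] K, ε (g * h) = Γ.mul (ε g) (ε h)) (σ₀ : K →+* ℂ)
    (ΘE ΘT : CMType K)
    (hΘE : ∀ g : K ≃ₐ[ℚ] K, σ₀.comp (g : K →+* K) ∈ ΘE.1 ↔ mem (ε g) 1365 = true)
    (hΘT : ∀ g : K ≃ₐ[ℚ] K, σ₀.comp (g : K →+* K) ∈ ΘT.1 ↔ mem (ε g) 952 = true) :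
    HodgeConjectureFor (cmProdAV K cmAbelianVarietyRealised_holds 1 ![ΘE, ΘT]).dim
      (cmProdAV K cmAbelianVarietyRealised_holds 1 ![ΘE, ΘT]).X :=
  hodgeConjectureFor_cmProdAV_of_reads_of_masks hW4 Γ ε hε σ₀ (by decide +kernel) 1365 65 1365 952 (by decide +kernel) (by decide +kernel)
    (by decide +kernel) (by decide +kernel) (by decide +kernel) (by decide +kernel) (by decide +kernel) (by decide +kernel) (by decide +kernel) 3 4 (by decide +kernel) (by decide +kernel) (by decide +kernel)
    ΘE ΘT hΘE hΘT

/-- **`D₆`, family `(1386; 903)`**: `Θ_E` reading as `{1,3,5,6,8,10}` (the coset `c·⟨r², sr⟩`; `Θ_E = {σ̄₀|_{k₁}}^K`), `Θ_T` reading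
as `{0,1,2,7,8,9}` (stabiliser `{1, sr³}`; induced from `K^{⟨sr³⟩} ⊇ k₁`).  (FRAMING: conditional; `HC_CM` is not proved.)
[cite: Markman2025SurveySecant, Thm. 1.2] [cite: Shimura1998, §6.2 Theorem 3 and §8.2] -/
theorem hodgeConjectureFor_cmProdAV_of_reads_d6_1386_903
    (hW4 : Markman2025_weilClasses_algebraic_abelianFourfold) {K : Type} [Field K] [NumberField K] [IsCMField K]
    [IsGalois ℚ K] (ε : (K ≃ₐ[ℚ] K) ≃ Fin 12) (hε : ∀ g h : K ≃ₐ[ℚ] K, ε (g * h) = Γ.mul (ε g) (ε h)) (σ₀ : K →+* ℂ)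
    (ΘE ΘT : CMType K)
    (hΘE : ∀ g : K ≃ₐ[ℚ] K, σ₀.comp (g : K →+* K) ∈ ΘE.1 ↔ mem (ε g) 1386 = true)
    (hΘT : ∀ g : K ≃ₐ[ℚ] K, σ₀.comp (g : K →+* K) ∈ ΘT.1 ↔ mem (ε g) 903 = true) :
    HodgeConjectureFor (cmProdAV K cmAbelianVarietyRealised_holds 1 ![ΘE, ΘT]).dim
      (cmProdAV K cmAbelianVarietyRealised_holds 1 ![ΘE, ΘT]).X :=
  hodgeConjectureFor_cmProdAV_of_reads_of_masks hW4 Γ ε hε σ₀ (by decide +kernel) 2709 513 1386 903 (by decide +kernel) (by decide +kernel)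
    (by decide +kernel) (by decide +kernel) (by decide +kernel) (by decide +kernel) (by decide +kernel) (by decide +kernel) (by decide +kernel) 0 1 (by decide +kernel) (by decide +kernel) (by decide +kernel)
    ΘE ΘT hΘE hΘT

/-- **`D₆`, family `(1386; 924)`** (= seat b23's `![E₁,T₃]`): `Θ_T` reading as `{2,3,4,7,8,9}` (stabiliser `{1, sr⁵}`; induced from
`L₅ = K^{⟨sr⁵⟩} ⊇ k₁`).
(FRAMING: conditional; `HC_CM` is not proved.) [cite: Markman2025SurveySecant, Thm. 1.2] [cite: Shimura1998, §6.2 Theorem 3 and §8.2] -/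
theorem hodgeConjectureFor_cmProdAV_of_reads_d6_1386_924
    (hW4 : Markman2025_weilClasses_algebraic_abelianFourfold) {K : Type} [Field K] [NumberField K] [IsCMField K]
    [IsGalois ℚ K] (ε : (K ≃ₐ[ℚ] K) ≃ Fin 12) (hε : ∀ g h : K ≃ₐ[ℚ] K, ε (g * h) = Γ.mul (ε g) (ε h)) (σ₀ : K →+* ℂ)
    (ΘE ΘT : CMType K)
    (hΘE : ∀ g : K ≃ₐ[ℚ] K, σ₀.comp (g : K →+* K) ∈ ΘE.1 ↔ mem (ε g) 1386 = true)
    (hΘT : ∀ g : K ≃ₐ[ℚ] K, σ₀.comp (g : K →+* K) ∈ ΘT.1 ↔ mem (ε g) 924 = true) :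
    HodgeConjectureFor (cmProdAV K cmAbelianVarietyRealised_holds 1 ![ΘE, ΘT]).dim
      (cmProdAV K cmAbelianVarietyRealised_holds 1 ![ΘE, ΘT]).X :=
  hodgeConjectureFor_cmProdAV_of_reads_of_masks hW4 Γ ε hε σ₀ (by decide +kernel) 2709 2049 1386 924 (by decide +kernel) (by decide +kernel)
    (by decide +kernel) (by decide +kernel) (by decide +kernel) (by decide +kernel) (by decide +kernel) (by decide +kernel) (by decide +kernel) 2 3 (by decide +kernel) (by decide +kernel) (by decide +kernel)
    ΘE ΘT hΘE hΘT

/-- **`D₆`, family `(1386; 945)`**: `Θ_T` reading as `{0,4,5,7,8,9}` (stabiliser `{1, sr}`; induced from `K^{⟨sr⟩} ⊇ k₁`).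
(FRAMING: conditional; `HC_CM` is not proved.) [cite: Markman2025SurveySecant, Thm. 1.2] [cite: Shimura1998, §6.2 Theorem 3 and §8.2] -/
theorem hodgeConjectureFor_cmProdAV_of_reads_d6_1386_945
    (hW4 : Markman2025_weilClasses_algebraic_abelianFourfold) {K : Type} [Field K] [NumberField K] [IsCMField K]
    [IsGalois ℚ K] (ε : (K ≃ₐ[ℚ] K) ≃ Fin 12) (hε : ∀ g h : K ≃ₐ[ℚ] K, ε (g * h) = Γ.mul (ε g) (ε h)) (σ₀ : K →+* ℂ)
    (ΘE ΘT : CMType K)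
    (hΘE : ∀ g : K ≃ₐ[ℚ] K, σ₀.comp (g : K →+* K) ∈ ΘE.1 ↔ mem (ε g) 1386 = true)
    (hΘT : ∀ g : K ≃ₐ[ℚ] K, σ₀.comp (g : K →+* K) ∈ ΘT.1 ↔ mem (ε g) 945 = true) :
    HodgeConjectureFor (cmProdAV K cmAbelianVarietyRealised_holds 1 ![ΘE, ΘT]).dim
      (cmProdAV K cmAbelianVarietyRealised_holds 1 ![ΘE, ΘT]).X :=
  hodgeConjectureFor_cmProdAV_of_reads_of_masks hW4 Γ ε hε σ₀ (by decide +kernel) 2709 129 1386 945 (by decide +kernel) (by decide +kernel)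
    (by decide +kernel) (by decide +kernel) (by decide +kernel) (by decide +kernel) (by decide +kernel) (by decide +kernel) (by decide +kernel) 0 5 (by decide +kernel) (by decide +kernel) (by decide +kernel)
    ΘE ΘT hΘE hΘT

/-- **`D₆`, family `(2730; 952)`** (seat b23's `![E₀,T₁]`, HOME/INBOX l.5711: `Θ_E` reading as `{1,3,5,7,9,11}` = the coset `c·⟨r², s⟩`, i.e. `Θ_E = {σ̄₀|_{k₀}}^K`; `Θ_T` reading as `{3,4,5,7,8,9}`, induced from `L₀ = K^{⟨s⟩} ⊇ k₀`).  (FRAMING: conditional; `HC_CM` is not proved.)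
[cite: Markman2025SurveySecant, Thm. 1.2] [cite: Shimura1998, §6.2 Theorem 3 and §8.2] -/
theorem hodgeConjectureFor_cmProdAV_of_reads_d6_2730_952
    (hW4 : Markman2025_weilClasses_algebraic_abelianFourfold) {K : Type} [Field K] [NumberField K] [IsCMField K]
    [IsGalois ℚ K] (ε : (K ≃ₐ[ℚ] K) ≃ Fin 12) (hε : ∀ g h : K ≃ₐ[ℚ] K, ε (g * h) = Γ.mul (ε g) (ε h)) (σ₀ : K →+* ℂ)
    (ΘE ΘT : CMType K)
    (hΘE : ∀ g : K ≃ₐ[ℚ] K, σ₀.comp (g : K →+* K) ∈ ΘE.1 ↔ mem (ε g) 2730 = true)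
    (hΘT : ∀ g : K ≃ₐ[ℚ] K, σ₀.comp (g : K →+* K) ∈ ΘT.1 ↔ mem (ε g) 952 = true) :
    HodgeConjectureFor (cmProdAV K cmAbelianVarietyRealised_holds 1 ![ΘE, ΘT]).dim
      (cmProdAV K cmAbelianVarietyRealised_holds 1 ![ΘE, ΘT]).X :=
  hodgeConjectureFor_cmProdAV_of_reads_of_masks hW4 Γ ε hε σ₀ (by decide +kernel) 1365 65 2730 952 (by decide +kernel) (by decide +kernel)
    (by decide +kernel) (by decide +kernel) (by decide +kernel) (by decide +kernel) (by decide +kernel) (by decide +kernel) (by decide +kernel) 3 4 (by decide +kernel) (by decide +kernel) (by decide +kernel)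
    ΘE ΘT hΘE hΘT

/-- **`D₆`, family `(2730; 3598)`** (seat b23's `![E₀,T₂]`: `Θ_T` reading as `{1,2,3,9,10,11}`, stabiliser `{1, s}`, induced from `L₀ = K^{⟨s⟩} ⊇ k₀`).  (FRAMING: conditional; `HC_CM` is not proved.)
[cite: Markman2025SurveySecant, Thm. 1.2] [cite: Shimura1998, §6.2 Theorem 3 and §8.2] -/
theorem hodgeConjectureFor_cmProdAV_of_reads_d6_2730_3598
    (hW4 : Markman2025_weilClasses_algebraic_abelianFourfold) {K : Type} [Field K] [NumberField K] [IsCMField K]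
    [IsGalois ℚ K] (ε : (K ≃ₐ[ℚ] K) ≃ Fin 12) (hε : ∀ g h : K ≃ₐ[ℚ] K, ε (g * h) = Γ.mul (ε g) (ε h)) (σ₀ : K →+* ℂ)
    (ΘE ΘT : CMType K)
    (hΘE : ∀ g : K ≃ₐ[ℚ] K, σ₀.comp (g : K →+* K) ∈ ΘE.1 ↔ mem (ε g) 2730 = true)
    (hΘT : ∀ g : K ≃ₐ[ℚ] K, σ₀.comp (g : K →+* K) ∈ ΘT.1 ↔ mem (ε g) 3598 = true) :
    HodgeConjectureFor (cmProdAV K cmAbelianVarietyRealised_holds 1 ![ΘE, ΘT]).dim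
      (cmProdAV K cmAbelianVarietyRealised_holds 1 ![ΘE, ΘT]).X :=
  hodgeConjectureFor_cmProdAV_of_reads_of_masks hW4 Γ ε hε σ₀ (by decide +kernel) 1365 65 2730 3598 (by decide +kernel) (by decide +kernel)
    (by decide +kernel) (by decide +kernel) (by decide +kernel) (by decide +kernel) (by decide +kernel) (by decide +kernel) (by decide +kernel) 1 2 (by decide +kernel) (by decide +kernel) (by decide +kernel)
    ΘE ΘT hΘE hΘT

/-- **`D₆`, family `(1386; 1806)`** (seat b23's `![E₁,T₄]`: `Θ_E = {σ̄₀|_{k₁}}^K` (code `{1,3,5,6,8,10}`), `Θ_T` reading as `{1,2,3,8,9,10}`, stabiliser `{1, sr⁵}`, induced from `L₅ = K^{⟨sr⁵⟩} ⊇ k₁`).  (FRAMING: conditional; `HC_CM` is not proved.)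
[cite: Markman2025SurveySecant, Thm. 1.2] [cite: Shimura1998, §6.2 Theorem 3 and §8.2] -/
theorem hodgeConjectureFor_cmProdAV_of_reads_d6_1386_1806
    (hW4 : Markman2025_weilClasses_algebraic_abelianFourfold) {K : Type} [Field K] [NumberField K] [IsCMField K]
    [IsGalois ℚ K] (ε : (K ≃ₐ[ℚ] K) ≃ Fin 12) (hε : ∀ g h : K ≃ₐ[ℚ] K, ε (g * h) = Γ.mul (ε g) (ε h)) (σ₀ : K →+* ℂ)
    (ΘE ΘT : CMType K)
    (hΘE : ∀ g : K ≃ₐ[ℚ] K, σ₀.comp (g : K →+* K) ∈ ΘE.1 ↔ mem (ε g) 1386 = true)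
    (hΘT : ∀ g : K ≃ₐ[ℚ] K, σ₀.comp (g : K →+* K) ∈ ΘT.1 ↔ mem (ε g) 1806 = true) :
    HodgeConjectureFor (cmProdAV K cmAbelianVarietyRealised_holds 1 ![ΘE, ΘT]).dim
      (cmProdAV K cmAbelianVarietyRealised_holds 1 ![ΘE, ΘT]).X :=
  hodgeConjectureFor_cmProdAV_of_reads_of_masks hW4 Γ ε hε σ₀ (by decide +kernel) 2709 2049 1386 1806 (by decide +kernel) (by decide +kernel)
    (by decide +kernel) (by decide +kernel) (by decide +kernel) (by decide +kernel) (by decide +kernel) (by decide +kernel) (by decide +kernel) 1 2 (by decide +kernel) (by decide +kernel) (by decide +kernel)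
    ΘE ΘT hΘE hΘT

end D6

/-! ## §3 Type `ℤ/6×ℤ/2`: three families (b07 ∪ b23) -/

section C6C2

open Summit.HodgeConjecture.CorCM.Census.DuodecicFaceGeneratorsC6C2 (Γ)

/-- **`ℤ/6×ℤ/2`, family `(1365; 910)`**: `Θ_E` reading as `{0,2,4,6,8,10}` (the subgroup `ℤ/3 × ℤ/2`), `Θ_T` reading as
`{1,2,3,7,8,9}` (stabiliser `{(0,0), (0,1)}`; induced from the sextic CM field `K^{ℤ/2} ⊇ k₀`) ⟹ `HC(A_{Θ_E} × A_{Θ_T})` GIVEN ONLY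
Markman's fourfold theorem.  (FRAMING: conditional; `HC_CM` is not proved.) [cite: Markman2025SurveySecant, Thm. 1.2]
[cite: Shimura1998, §6.2 Theorem 3 and §8.2] -/
theorem hodgeConjectureFor_cmProdAV_of_reads_c6c2_1365_910
    (hW4 : Markman2025_weilClasses_algebraic_abelianFourfold) {K : Type} [Field K] [NumberField K] [IsCMField K]
    [IsGalois ℚ K] (ε : (K ≃ₐ[ℚ] K) ≃ Fin 12) (hε : ∀ g h : K ≃ₐ[ℚ] K, ε (g * h) = Γ.mul (ε g) (ε h)) (σ₀ : K →+* ℂ)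
    (ΘE ΘT : CMType K)
    (hΘE : ∀ g : K ≃ₐ[ℚ] K, σ₀.comp (g : K →+* K) ∈ ΘE.1 ↔ mem (ε g) 1365 = true)
    (hΘT : ∀ g : K ≃ₐ[ℚ] K, σ₀.comp (g : K →+* K) ∈ ΘT.1 ↔ mem (ε g) 910 = true) :
    HodgeConjectureFor (cmProdAV K cmAbelianVarietyRealised_holds 1 ![ΘE, ΘT]).dim
      (cmProdAV K cmAbelianVarietyRealised_holds 1 ![ΘE, ΘT]).X :=
  hodgeConjectureFor_cmProdAV_of_reads_of_masks hW4 Γ ε hε σ₀ (by decide +kernel) 1365 65 1365 910 (by decide +kernel) (by decide +kernel)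
    (by decide +kernel) (by decide +kernel) (by decide +kernel) (by decide +kernel) (by decide +kernel) (by decide +kernel) (by decide +kernel) 1 2 (by decide +kernel) (by decide +kernel) (by decide +kernel)
    ΘE ΘT hΘE hΘT

/-- **`ℤ/6×ℤ/2`, family `(1386; 945)`**: `Θ_E` reading as `{1,3,5,6,8,10}` (the coset `c + ⟨(2,0),(1,1)⟩`), `Θ_T` reading as
`{0,4,5,7,8,9}` (stabiliser `{(0,0), (3,1)}`; induced from `K^{⟨(3,1)⟩} ⊇ k₁`).  (FRAMING: conditional; `HC_CM` is not proved.)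
[cite: Markman2025SurveySecant, Thm. 1.2] [cite: Shimura1998, §6.2 Theorem 3 and §8.2] -/
theorem hodgeConjectureFor_cmProdAV_of_reads_c6c2_1386_945
    (hW4 : Markman2025_weilClasses_algebraic_abelianFourfold) {K : Type} [Field K] [NumberField K] [IsCMField K]
    [IsGalois ℚ K] (ε : (K ≃ₐ[ℚ] K) ≃ Fin 12) (hε : ∀ g h : K ≃ₐ[ℚ] K, ε (g * h) = Γ.mul (ε g) (ε h)) (σ₀ : K →+* ℂ)
    (ΘE ΘT : CMType K)
    (hΘE : ∀ g : K ≃ₐ[ℚ] K, σ₀.comp (g : K →+* K) ∈ ΘE.1 ↔ mem (ε g) 1386 = true)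
    (hΘT : ∀ g : K ≃ₐ[ℚ] K, σ₀.comp (g : K →+* K) ∈ ΘT.1 ↔ mem (ε g) 945 = true) :
    HodgeConjectureFor (cmProdAV K cmAbelianVarietyRealised_holds 1 ![ΘE, ΘT]).dim
      (cmProdAV K cmAbelianVarietyRealised_holds 1 ![ΘE, ΘT]).X :=
  hodgeConjectureFor_cmProdAV_of_reads_of_masks hW4 Γ ε hε σ₀ (by decide +kernel) 2709 513 1386 945 (by decide +kernel) (by decide +kernel)
    (by decide +kernel) (by decide +kernel) (by decide +kernel) (by decide +kernel) (by decide +kernel) (by decide +kernel) (by decide +kernel) 0 5 (by decide +kernel) (by decide +kernel) (by decide +kernel)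
    ΘE ΘT hΘE hΘT

/-- **`ℤ/6×ℤ/2`, family `(1365; 3640)`** (seat b23's `![E₀,T₁]`, `Census/DuodecicFaceTransportC6C2OfMarkman.lean` p305337: `Θ_E`
reading as the subgroup `2ℤ/6 × ℤ/2`, `Θ_T` reading as `{3,4,5,9,10,11}`, stabiliser `{(0,0), (0,1)}`, induced from the cyclic sextic CM
field `K^{⟨(0,1)⟩} ⊇ k₀`).  (FRAMING: conditional; `HC_CM` is not proved.) [cite: Markman2025SurveySecant, Thm. 1.2]
[cite: Shimura1998, §6.2 Theorem 3 and §8.2] -/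
theorem hodgeConjectureFor_cmProdAV_of_reads_c6c2_1365_3640
    (hW4 : Markman2025_weilClasses_algebraic_abelianFourfold) {K : Type} [Field K] [NumberField K] [IsCMField K]
    [IsGalois ℚ K] (ε : (K ≃ₐ[ℚ] K) ≃ Fin 12) (hε : ∀ g h : K ≃ₐ[ℚ] K, ε (g * h) = Γ.mul (ε g) (ε h)) (σ₀ : K →+* ℂ)
    (ΘE ΘT : CMType K)
    (hΘE : ∀ g : K ≃ₐ[ℚ] K, σ₀.comp (g : K →+* K) ∈ ΘE.1 ↔ mem (ε g) 1365 = true)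
    (hΘT : ∀ g : K ≃ₐ[ℚ] K, σ₀.comp (g : K →+* K) ∈ ΘT.1 ↔ mem (ε g) 3640 = true) :
    HodgeConjectureFor (cmProdAV K cmAbelianVarietyRealised_holds 1 ![ΘE, ΘT]).dim
      (cmProdAV K cmAbelianVarietyRealised_holds 1 ![ΘE, ΘT]).X :=
  hodgeConjectureFor_cmProdAV_of_reads_of_masks hW4 Γ ε hε σ₀ (by decide +kernel) 1365 65 1365 3640 (by decide +kernel) (by decide +kernel)
    (by decide +kernel) (by decide +kernel) (by decide +kernel) (by decide +kernel) (by decide +kernel) (by decide +kernel) (by decide +kernel) 3 4 (by decide +kernel) (by decide +kernel) (by decide +kernel)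
    ΘE ΘT hΘE hΘT

end C6C2

/-! ## §4 Bundles in seat b23's binder shape: the reading types EXIST and their Markman families hold -/

section Bundles

/-- **`D₆` bundle (seat b23's `E₀ E₁ T₁ T₂ T₃ T₄`).**  For a Galois CM field `K` with the automorphism dictionary `(σ₀, ε, c)` of the
`…_aut` closure theorems (`ε` multiplicative for the `D₆` table, `σ₀ ∘ c = σ̄₀`, `ε c = Γ.conj`), there EXIST CM types `E₀, E₁, T₁, T₂,
T₃, T₄` of `K` reading as `2730, 1386, 952, 3598, 924, 1806` (`FaceCensus.exists_cmType_reads`), and — GIVEN ONLY Markman's fourfold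
theorem — the four products `A_{E₀} × A_{T₁}`, `A_{E₀} × A_{T₂}`, `A_{E₁} × A_{T₃}`, `A_{E₁} × A_{T₄}` of the record satisfy the Hodge
conjecture in every codimension (§2): exactly the binders `E₀ … T₄`, `hE₀ … hT₄` (through `FaceCensus.reads_galT_of_reads_aut`) and
`hHC₁ … hHC₄` of seat b23's `…_of_facePeriods_of_hodgeConjectureFor_duodecicDihedral`.  (FRAMING: conditional on Markman's theorem;
`HC_CM` is not proved; no period is produced.) [cite: Markman2025SurveySecant, Thm. 1.2] [cite: Shimura1998, §6.2 Theorem 3 and §8.2] -/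
theorem exists_families_d6 (hW4 : Markman2025_weilClasses_algebraic_abelianFourfold) {K : Type} [Field K] [NumberField K]
    [IsCMField K] [IsGalois ℚ K] (σ₀ : K →+* ℂ) (ε : (K ≃ₐ[ℚ] K) ≃ Fin 12)
    (hε : ∀ g h : K ≃ₐ[ℚ] K, ε (g * h) = Census.DuodecicFaceGeneratorsDihedral.Γ.mul (ε g) (ε h))
    (c : K ≃ₐ[ℚ] K) (hc : σ₀.comp (c : K →+* K) = conjugate σ₀) (hεc : ε c = Census.DuodecicFaceGeneratorsDihedral.Γ.conj) :
    ∃ E₀ E₁ T₁ T₂ T₃ T₄ : CMType K,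
      (∀ g : K ≃ₐ[ℚ] K, σ₀.comp (g : K →+* K) ∈ E₀.1 ↔ mem (ε g) 2730 = true) ∧
      (∀ g : K ≃ₐ[ℚ] K, σ₀.comp (g : K →+* K) ∈ E₁.1 ↔ mem (ε g) 1386 = true) ∧
      (∀ g : K ≃ₐ[ℚ] K, σ₀.comp (g : K →+* K) ∈ T₁.1 ↔ mem (ε g) 952 = true) ∧
      (∀ g : K ≃ₐ[ℚ] K, σ₀.comp (g : K →+* K) ∈ T₂.1 ↔ mem (ε g) 3598 = true) ∧
      (∀ g : K ≃ₐ[ℚ] K, σ₀.comp (g : K →+* K) ∈ T₃.1 ↔ mem (ε g) 924 = true) ∧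
      (∀ g : K ≃ₐ[ℚ] K, σ₀.comp (g : K →+* K) ∈ T₄.1 ↔ mem (ε g) 1806 = true) ∧
      HodgeConjectureFor (cmProdAV K cmAbelianVarietyRealised_holds 1 ![E₀, T₁]).dim
        (cmProdAV K cmAbelianVarietyRealised_holds 1 ![E₀, T₁]).X ∧
      HodgeConjectureFor (cmProdAV K cmAbelianVarietyRealised_holds 1 ![E₀, T₂]).dim
        (cmProdAV K cmAbelianVarietyRealised_holds 1 ![E₀, T₂]).X ∧
      HodgeConjectureFor (cmProdAV K cmAbelianVarietyRealised_holds 1 ![E₁, T₃]).dim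
        (cmProdAV K cmAbelianVarietyRealised_holds 1 ![E₁, T₃]).X ∧
      HodgeConjectureFor (cmProdAV K cmAbelianVarietyRealised_holds 1 ![E₁, T₄]).dim
        (cmProdAV K cmAbelianVarietyRealised_holds 1 ![E₁, T₄]).X := by
  obtain ⟨E₀, hE₀⟩ := exists_cmType_reads Census.DuodecicFaceGeneratorsDihedral.Γ ε hε σ₀ hc hεc 2730 (by decide +kernel)
  obtain ⟨E₁, hE₁⟩ := exists_cmType_reads Census.DuodecicFaceGeneratorsDihedral.Γ ε hε σ₀ hc hεc 1386 (by decide +kernel)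
  obtain ⟨T₁, hT₁⟩ := exists_cmType_reads Census.DuodecicFaceGeneratorsDihedral.Γ ε hε σ₀ hc hεc 952 (by decide +kernel)
  obtain ⟨T₂, hT₂⟩ := exists_cmType_reads Census.DuodecicFaceGeneratorsDihedral.Γ ε hε σ₀ hc hεc 3598 (by decide +kernel)
  obtain ⟨T₃, hT₃⟩ := exists_cmType_reads Census.DuodecicFaceGeneratorsDihedral.Γ ε hε σ₀ hc hεc 924 (by decide +kernel)
  obtain ⟨T₄, hT₄⟩ := exists_cmType_reads Census.DuodecicFaceGeneratorsDihedral.Γ ε hε σ₀ hc hεc 1806 (by decide +kernel)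
  exact ⟨E₀, E₁, T₁, T₂, T₃, T₄, hE₀, hE₁, hT₁, hT₂, hT₃, hT₄,
    hodgeConjectureFor_cmProdAV_of_reads_d6_2730_952 hW4 ε hε σ₀ E₀ T₁ hE₀ hT₁,
    hodgeConjectureFor_cmProdAV_of_reads_d6_2730_3598 hW4 ε hε σ₀ E₀ T₂ hE₀ hT₂,
    hodgeConjectureFor_cmProdAV_of_reads_d6_1386_924 hW4 ε hε σ₀ E₁ T₃ hE₁ hT₃,
    hodgeConjectureFor_cmProdAV_of_reads_d6_1386_1806 hW4 ε hε σ₀ E₁ T₄ hE₁ hT₄⟩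

/-- **`ℤ/6×ℤ/2` bundle (seat b23's `E₀ T₁`).**  With the dictionary `(σ₀, ε, c)` for the `ℤ/6×ℤ/2` table there EXIST CM types `E₀`,
`T₁` reading as `1365`, `3640`, and `A_{E₀} × A_{T₁}` of the record satisfies the Hodge conjecture in every codimension GIVEN ONLY
Markman's fourfold theorem — the binders `E₀ T₁ hE₀ hT₁ hHC₁` of seat b23's `…_of_facePeriods_of_hodgeConjectureFor_duodecicC6C2`.
(FRAMING: conditional; `HC_CM` is not proved.) [cite: Markman2025SurveySecant, Thm. 1.2] [cite: Shimura1998, §6.2 Theorem 3 and §8.2] -/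
theorem exists_families_c6c2 (hW4 : Markman2025_weilClasses_algebraic_abelianFourfold) {K : Type} [Field K] [NumberField K]
    [IsCMField K] [IsGalois ℚ K] (σ₀ : K →+* ℂ) (ε : (K ≃ₐ[ℚ] K) ≃ Fin 12)
    (hε : ∀ g h : K ≃ₐ[ℚ] K, ε (g * h) = Census.DuodecicFaceGeneratorsC6C2.Γ.mul (ε g) (ε h))
    (c : K ≃ₐ[ℚ] K) (hc : σ₀.comp (c : K →+* K) = conjugate σ₀) (hεc : ε c = Census.DuodecicFaceGeneratorsC6C2.Γ.conj) :
    ∃ E₀ T₁ : CMType K,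
      (∀ g : K ≃ₐ[ℚ] K, σ₀.comp (g : K →+* K) ∈ E₀.1 ↔ mem (ε g) 1365 = true) ∧
      (∀ g : K ≃ₐ[ℚ] K, σ₀.comp (g : K →+* K) ∈ T₁.1 ↔ mem (ε g) 3640 = true) ∧
      HodgeConjectureFor (cmProdAV K cmAbelianVarietyRealised_holds 1 ![E₀, T₁]).dim
        (cmProdAV K cmAbelianVarietyRealised_holds 1 ![E₀, T₁]).X := by
  obtain ⟨E₀, hE₀⟩ := exists_cmType_reads Census.DuodecicFaceGeneratorsC6C2.Γ ε hε σ₀ hc hεc 1365 (by decide +kernel)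
  obtain ⟨T₁, hT₁⟩ := exists_cmType_reads Census.DuodecicFaceGeneratorsC6C2.Γ ε hε σ₀ hc hεc 3640 (by decide +kernel)
  exact ⟨E₀, T₁, hE₀, hT₁, hodgeConjectureFor_cmProdAV_of_reads_c6c2_1365_3640 hW4 ε hε σ₀ E₀ T₁ hE₀ hT₁⟩

end Bundles

end Summit.HodgeConjecture.CorCM.DuodecicMarkmanFamilies

end
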